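import Summits.BirchSwinnertonDyer.BirchSwinnertonDyer.Theorems.GenusKolyvaginAtTwoPowDvdShaCardAtTwoRTLadderFrame
import HarnessLib

/-!
# Route `GenusKolyvaginAtTwo`, LINE 18 v5 (L_T `PowDvdShaCardAtTwoRT`, stmt-BirchSwinnertonDyer-23242), stub J
# `stub_jointGenusCountAtTwo` — GENUS LADDERS: the registered cross-side count is contradicted by inflation classes

Seat `bsd-line-gk2-p2` g17 (cell `bsd-f1-sign2`), `--supports stmt-BirchSwinnertonDyer-23242` (helper; closes nothing).
THEOREMS ONLY (no definition, no named fact, no `sorry`); BSD is not proved by any of this; J is NOT proved (it is audited).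

WHAT.  The registered stub J of LINE 18 v5 (`Cruxes/PowDvdShaCardAtTwoRT/Lines/plus_descent.lean`) is the PURE COUNT: for every
`(W, K, Wd)` on the twin frame with `B := ord₂ C(Wd) ≥ 2` and finite `Ш(W/ℚ)[2^∞]`, `Ш(Wd/ℚ)[2^∞]` (orders `g, g′`), EVERY pair of
abstract ladders (for each `m < T`: `2m+2` independent classes in `H¹(ℚ, W)` of order `2^{M_{2m} − M_{2m+1}}` whose restrictions to
`K` lie in `Ш(W_K/K)`, and `2m+2` independent classes in `H¹(ℚ, Wd)` of order `2^{M_{2m+1} − M_{2m+2}}` with restrictions in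
`Ш(Wd_K/K)`, `M` antitone, `M_{2T} = 0`) satisfies `2·M₀ ≤ ord₂ g + ord₂ g′ + B`.

THE COUNTER-MECHANISM (this file).  Classes of `H¹(ℚ, X)` that DIE over `K` — the inflation of `H¹(Gal(K/ℚ), X(K))`, e.g. the
genus classes `τ ↦ P` of points `P ∈ X(K)` with `τP = −P` (twist points `ψ(X^{(d_K)}(ℚ))`, rational `2`-torsion) — restrict to
`0 ∈ Ш(X_K/K)` and are killed by `2`.  So `2m+2` classes of order `2` in `ker(H¹(ℚ, W) → H¹(K, W_K))`, `𝔽₂`-independent, and the same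
in `ker(H¹(ℚ, Wd) → H¹(K, Wd_K))`, for every `m < T`, ARE a pair of J-ladders with `M_j := 2T − j` (`M₀ = 2T`, every rung of height
`1`): `genusLadder_of_kerFamilies`.  Consequences:

* `four_mul_le_frame_of_kerFamilies` (TRUE, unconditional — gk2-p3's frame theorem `two_mul_le_padicValNat_add_of_shaLadders`
  fed with genus ladders): `4T ≤ ord₂ g + ord₂ g′ + 4⌊B/2⌋` — the genus/capitulation kernel is bounded by `Ш` and the genus budget;
* `four_mul_le_of_jointGenusCount` (J as hypothesis, VERBATIM the registered signature): J ⟹ `4T ≤ ord₂ g + ord₂ g′ + B`;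
* `not_jointGenusCount_of_kerPairs`: a single frame row with `ord₂ g + ord₂ g′ + ord₂ C(Wd) < 4` (on `Δ < 0`: `B = 3` by the genus
  parity GP and `Ш(W)[2] = Ш(Wd)[2] = 0`) carrying TWO independent order-`2` classes dying over `K` on EACH side REFUTES J.  Such rows
  are off the GK2 habitat (they need `H¹(Gal(K/ℚ), W(K))[2]` and `H¹(Gal(K/ℚ), Wd(K))[2]` of `𝔽₂`-rank `≥ 2`, i.e. `W(ℚ)` and
  `W^{(d_K)}(ℚ)` each of `2`-rank `≥ 2` modulo norms: e.g. `W(ℚ) ⊇ ℤ/2 × ℤ`, `W^{(d_K)}(ℚ) ⊇ ℤ/2 × ℤ`, both `Ш[2] = 0`, three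
  `2`-torsion directions at the primes of `d_K`), but J is typed habitat-free («PURE COUNT, crux-antecedent-free»), so J AS REGISTERED
  is false as soon as one such row is certified; the certification (two `2`-isogeny descents, Tamagawa numbers, conductor, the two
  inflation classes) is NOT done here — this file isolates the exact row predicate (`not_jointGenusCount_of_kerPairs`'s hypotheses).
  ON the habitat (`rank W(ℚ) = 0`, `W(ℚ)[2] = 0`) the same saturation happens through LIFTS of `Ш(W_K)[2]`: on a habitat row with
  `B = 3` and `Ш(W)[2] = Ш(Wd)[2] = 0`, Kramer's Remark after Thm. 1 (`Sel₂(W/ℚ) = 0 ⇒ dim Sel₂(W_K) = Σ i_v = B`, all classes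
  ambiguous) gives `Ш(W_K)[2^∞] = (ℤ/2)²` with `τ = id`, and the Poitou–Tate count gives `#res⁻¹Ш(Wd_K)[2^∞] = 4`, `#res⁻¹Ш(W_K)[2^∞] = 8`:
  again a pair of J-ladders with `M₀ = 2 > 3/2` (memo `Lines/plus-descent-stubJ-audit.md`).  The general law behind both:
  `q₊ + q₋ = B + ord₂ #H¹(Gal(K/ℚ), Ш(W_K)[2^∞]) − c` (`c ∈ {0,1}`), so the joint genus loss exceeds `B` by the Galois
  cohomology of `Ш(W_K)[2^∞]`, which no abstract ladder hypothesis controls.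

References: [Kramer1981] Thm. 1 and the Remark following it, Prop. 7, Thm. 2, Prop. 8; [McCallumLMS1991] §5 Thm. 5.4;
[SilvermanAEC2009] X.4.14; [SerreGaloisCohomology1997] I.§2.6 (inflation–restriction).
-/

set_option autoImplicit false
-- the Theorems namespace of this sub repeats the summit name by design (D-0017 nested layout)
set_option linter.dupNamespace false

noncomputable section

open scoped Classical

namespace Summit.BirchSwinnertonDyer.BirchSwinnertonDyer.Theorems.GenusExact.PlusDescent

open WeierstrassCurve NumberField IsDedekindDomain Rat.HeightOneSpectrum Literature.NumberTheory.EllipticCurves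
  Literature.Barriers.BirchSwinnertonDyer

/-! ## §1 Families dying over `K` are ladder rungs of height one -/

section KerFamilies

variable (X : WeierstrassCurve ℚ) (K : Type) [Field K] [NumberField K]

/-- **A rung of height one from classes dying over `K`.**  `n` classes `x_i ∈ H¹(ℚ, X)` with `res_K x_i = 0`, each of order `2`,
`𝔽₂`-independent, satisfy the rung hypothesis of the LINE 18 ladders with exponent `1`: restrictions in `Ш(X_K/K)` (they are `0`),
orders `2^1`, independence modulo `2^1`.  (Inflation classes `τ ↦ P`, `τP = −P`, are such classes: inflation–restriction.)
[cite: SerreGaloisCohomology1997, I.§2.6] [cite: Kramer1981, Thm. 1] -/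
theorem rung_of_kerFamily {n : ℕ} (x : Fin n → X.galH1) (hres : ∀ i, resBaseChange X K (x i) = 0)
    (hord : ∀ i, addOrderOf (x i) = 2) (hind : ∀ c : Fin n → ℤ, ∑ i, c i • x i = 0 → ∀ i, (2 : ℤ) ∣ c i) :
    (∀ i, resBaseChange X K (x i) ∈ (X.baseChange K).sha) ∧ (∀ i, addOrderOf (x i) = 2 ^ 1) ∧
      ∀ c : Fin n → ℤ, ∑ i, c i • x i = 0 → ∀ i, ((2 ^ 1 : ℕ) : ℤ) ∣ c i := by
  refine ⟨fun i ↦ ?_, fun i ↦ by rw [pow_one]; exact hord i, fun c hc i ↦ ?_⟩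
  · rw [hres i]
    exact AddSubgroup.zero_mem _
  · have h := hind c hc i
    simpa using h

/-- The height-one ladder `M_j := 2T − j`: antitone, `M_0 = 2T`, `M_{2T} = 0`, and every rung `M_{2m} − M_{2m+1}`,
`M_{2m+1} − M_{2m+2}` (`m < T`) equals `1`. [folklore] -/
theorem heightOneLadder (T : ℕ) :
    (∀ j, 2 * T - (j + 1) ≤ 2 * T - j) ∧ 2 * T - 0 = 2 * T ∧ 2 * T - 2 * T = 0 ∧
      (∀ m < T, 2 * T - 2 * m - (2 * T - (2 * m + 1)) = 1) ∧ ∀ m < T, 2 * T - (2 * m + 1) - (2 * T - (2 * m + 2)) = 1 := by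
  refine ⟨fun j ↦ by omega, by omega, by omega, fun m hm ↦ by omega, fun m hm ↦ by omega⟩

/-- **GENUS LADDERS.**  If for every `m < T` there are `2m+2` `𝔽₂`-independent order-`2` classes in `ker(H¹(ℚ, W) → H¹(K, W_K))` and
`2m+2` such classes in `ker(H¹(ℚ, Wd) → H¹(K, Wd_K))`, then the two ladder hypotheses `hfam`, `hfam'` of J / of the frame theorem hold
for the height-one ladder `M_j = 2T − j` (so with `M₀ = 2T`). [cite: Kramer1981, Thm. 1] [cite: McCallumLMS1991, §5 Thm. 5.4] -/
theorem genusLadder_of_kerFamilies (Wd : WeierstrassCurve ℚ) (T : ℕ)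
    (hker : ∀ m < T, ∃ x : Fin (2 * m + 2) → X.galH1, (∀ i, resBaseChange X K (x i) = 0) ∧ (∀ i, addOrderOf (x i) = 2) ∧
      ∀ c : Fin (2 * m + 2) → ℤ, ∑ i, c i • x i = 0 → ∀ i, (2 : ℤ) ∣ c i)
    (hker' : ∀ m < T, ∃ x : Fin (2 * m + 2) → Wd.galH1, (∀ i, resBaseChange Wd K (x i) = 0) ∧ (∀ i, addOrderOf (x i) = 2) ∧
      ∀ c : Fin (2 * m + 2) → ℤ, ∑ i, c i • x i = 0 → ∀ i, (2 : ℤ) ∣ c i) :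
    (∀ j, (fun j ↦ 2 * T - j) (j + 1) ≤ (fun j ↦ 2 * T - j) j) ∧ (fun j ↦ 2 * T - j) 0 = 2 * T ∧
      (fun j ↦ 2 * T - j) (2 * T) = 0 ∧
      (∀ m < T, ∃ x : Fin (2 * m + 2) → X.galH1, (∀ i, resBaseChange X K (x i) ∈ (X.baseChange K).sha) ∧
        (∀ i, addOrderOf (x i) = 2 ^ ((fun j ↦ 2 * T - j) (2 * m) - (fun j ↦ 2 * T - j) (2 * m + 1))) ∧
        ∀ c : Fin (2 * m + 2) → ℤ, ∑ i, c i • x i = 0 →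
          ∀ i, ((2 ^ ((fun j ↦ 2 * T - j) (2 * m) - (fun j ↦ 2 * T - j) (2 * m + 1)) : ℕ) : ℤ) ∣ c i) ∧
      ∀ m < T, ∃ x : Fin (2 * m + 2) → Wd.galH1, (∀ i, resBaseChange Wd K (x i) ∈ (Wd.baseChange K).sha) ∧
        (∀ i, addOrderOf (x i) = 2 ^ ((fun j ↦ 2 * T - j) (2 * m + 1) - (fun j ↦ 2 * T - j) (2 * m + 2))) ∧
        ∀ c : Fin (2 * m + 2) → ℤ, ∑ i, c i • x i = 0 →
          ∀ i, ((2 ^ ((fun j ↦ 2 * T - j) (2 * m + 1) - (fun j ↦ 2 * T - j) (2 * m + 2)) : ℕ) : ℤ) ∣ c i := by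
  refine ⟨fun j ↦ by simp only; omega, by simp, by simp, fun m hm ↦ ?_, fun m hm ↦ ?_⟩
  · obtain ⟨x, hres, hord, hind⟩ := hker m hm
    have h1 : (fun j ↦ 2 * T - j) (2 * m) - (fun j ↦ 2 * T - j) (2 * m + 1) = 1 := by simp only; omega
    rw [h1]
    exact ⟨x, rung_of_kerFamily X K x hres hord hind⟩
  · obtain ⟨x, hres, hord, hind⟩ := hker' m hm
    have h1 : (fun j ↦ 2 * T - j) (2 * m + 1) - (fun j ↦ 2 * T - j) (2 * m + 2) = 1 := by simp only; omega
    rw [h1]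
    exact ⟨x, rung_of_kerFamily Wd K x hres hord hind⟩

end KerFamilies

/-! ## §2 What the frame theorem (true) and the stub J (registered) say about genus ladders -/

section Consequences

variable (W : WeierstrassCurve ℚ) [W.IsElliptic] [W.IsGloballyMinimal] (K : Type) [Field K] [NumberField K]
  {Wd : WeierstrassCurve ℚ} [Wd.IsElliptic]

/-- **Genus pairs are bounded by `Ш` and the genus budget (TRUE, from gk2-p3's frame theorem).**  On the LINE 18 frame, if for every
`m < T` each of `ker(H¹(ℚ, W) → H¹(K, W_K))`, `ker(H¹(ℚ, Wd) → H¹(K, Wd_K))` contains `2m+2` `𝔽₂`-independent classes of order `2`,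
then `4T ≤ ord₂ #Ш(W/ℚ)[2^∞] + ord₂ #Ш(Wd/ℚ)[2^∞] + 4⌊ord₂ C(Wd)/2⌋`.  (The capitulation kernels sit in `res⁻¹(Ш(·_K))`, whose index
over `Ш(·/ℚ)` is at most `2^{ord₂ C(Wd)}` per side.) [cite: Kramer1981, §2 Prop. 3, Thm. 1] [cite: McCallumLMS1991, §5 Thm. 5.4] -/
theorem four_mul_le_frame_of_kerFamilies (hΔ : W.Δ < 0) (hT : Odd W.tamagawaProduct)
    (hIQ : IsImaginaryQuadratic K) (hodd : Odd (NumberField.discr K)) (hHe : SatisfiesHeegnerHypothesis (W.conductorNorm ℤ) K)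
    (Cd : VariableChange ℚ) (hWd : Cd • W.quadraticTwist (NumberField.discr K : ℚ) = Wd)
    (hg : 0 < Nat.card (AddCommGroup.primaryComponent W.sha 2)) (hg' : 0 < Nat.card (AddCommGroup.primaryComponent Wd.sha 2))
    (T : ℕ)
    (hker : ∀ m < T, ∃ x : Fin (2 * m + 2) → W.galH1, (∀ i, resBaseChange W K (x i) = 0) ∧ (∀ i, addOrderOf (x i) = 2) ∧
      ∀ c : Fin (2 * m + 2) → ℤ, ∑ i, c i • x i = 0 → ∀ i, (2 : ℤ) ∣ c i)
    (hker' : ∀ m < T, ∃ x : Fin (2 * m + 2) → Wd.galH1, (∀ i, resBaseChange Wd K (x i) = 0) ∧ (∀ i, addOrderOf (x i) = 2) ∧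
      ∀ c : Fin (2 * m + 2) → ℤ, ∑ i, c i • x i = 0 → ∀ i, (2 : ℤ) ∣ c i) :
    4 * T ≤ padicValNat 2 (Nat.card (AddCommGroup.primaryComponent W.sha 2)) +
      padicValNat 2 (Nat.card (AddCommGroup.primaryComponent Wd.sha 2)) + 4 * (padicValNat 2 Wd.tamagawaProduct / 2) := by
  obtain ⟨hM, hM0, hMT, hfam, hfam'⟩ := genusLadder_of_kerFamilies W K Wd T hker hker'
  have h := two_mul_le_padicValNat_add_of_shaLadders W K hΔ hT hIQ hodd hHe Cd hWd hg hg' T (fun j ↦ 2 * T - j) hM hMT hfam hfam'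
  simp only [Nat.sub_zero] at h
  omega

/-- **What the registered stub J claims about genus ladders.**  The hypothesis `hJ` is VERBATIM the registered signature of
`stub_jointGenusCountAtTwo` (LINE 18 v5).  Fed with the genus ladders of §1 it asserts, for every frame row with `ord₂ C(Wd) ≥ 2`
and finite `Ш(W/ℚ)[2^∞]`, `Ш(Wd/ℚ)[2^∞]`: `4T ≤ ord₂ g + ord₂ g′ + ord₂ C(Wd)` whenever both capitulation kernels contain `(ℤ/2)^{2m+2}`
for all `m < T` — an improvement of the true `4⌊ord₂ C(Wd)/2⌋` to `ord₂ C(Wd)` that the arithmetic does not grant (see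
`not_jointGenusCount_of_kerPairs`). [cite: Kramer1981, Thm. 1, Prop. 7, Thm. 2] -/
theorem four_mul_le_of_jointGenusCount
    (hJ : ∀ (W : WeierstrassCurve ℚ) [W.IsElliptic] [W.IsGloballyMinimal], Odd W.tamagawaProduct → W.Δ < 0 → ∀ (K : Type) [Field K] [NumberField K], Literature.NumberTheory.EllipticCurves.IsImaginaryQuadratic K → Odd (NumberField.discr K) → Literature.NumberTheory.EllipticCurves.SatisfiesHeegnerHypothesis (W.conductorNorm ℤ) K → ∀ (M₀ : ℕ) (Wd : WeierstrassCurve ℚ) [Wd.IsElliptic] [Wd.IsGloballyMinimal], (∃ C : WeierstrassCurve.VariableChange ℚ, C • W.quadraticTwist (NumberField.discr K : ℚ) = Wd) → 2 ≤ padicValNat 2 Wd.tamagawaProduct → 0 < Nat.card (AddCommGroup.primaryComponent W.sha 2) → 0 < Nat.card (AddCommGroup.primaryComponent Wd.sha 2) → ∀ (T : ℕ) (M : ℕ → ℕ), (∀ j, M (j + 1) ≤ M j) → M 0 = M₀ → M (2 * T) = 0 → (∀ m < T, ∃ x : Fin (2 * m + 2) → W.galH1, (∀ i, resBaseChange W K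 (x i) ∈ (W.baseChange K).sha) ∧ (∀ i, addOrderOf (x i) = 2 ^ (M (2 * m) - M (2 * m + 1))) ∧ ∀ c : Fin (2 * m + 2) → ℤ, ∑ i, c i • x i = 0 → ∀ i, ((2 ^ (M (2 * m) - M (2 * m + 1)) : ℕ) : ℤ) ∣ c i) → (∀ m < T, ∃ x : Fin (2 * m + 2) → Wd.galH1, (∀ i, resBaseChange Wd K (x i) ∈ (Wd.baseChange K).sha) ∧ (∀ i, addOrderOf (x i) = 2 ^ (M (2 * m + 1) - M (2 * m + 2))) ∧ ∀ c : Fin (2 * m + 2) → ℤ, ∑ i, c i • x i = 0 → ∀ i, ((2 ^ (M (2 * m + 1) - M (2 * m + 2)) : ℕ) : ℤ) ∣ c i) → (2 * M₀ : ℤ) ≤ (padicValNat 2 (Nat.card (AddCommGroup.primaryComponent W.sha 2)) : ℤ) + (padicValNat 2 (Nat.card (AddCommGroup.primaryComponent Wd.sha 2)) : ℤ) + (padicValNat 2 Wd.tamagawaProduct : ℤ))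
    [Wd.IsGloballyMinimal] (hT : Odd W.tamagawaProduct) (hΔ : W.Δ < 0)
    (hIQ : IsImaginaryQuadratic K) (hodd : Odd (NumberField.discr K)) (hHe : SatisfiesHeegnerHypothesis (W.conductorNorm ℤ) K)
    (hTw : ∃ C : VariableChange ℚ, C • W.quadraticTwist (NumberField.discr K : ℚ) = Wd) (hB : 2 ≤ padicValNat 2 Wd.tamagawaProduct)
    (hg : 0 < Nat.card (AddCommGroup.primaryComponent W.sha 2)) (hg' : 0 < Nat.card (AddCommGroup.primaryComponent Wd.sha 2))
    (T : ℕ)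
    (hker : ∀ m < T, ∃ x : Fin (2 * m + 2) → W.galH1, (∀ i, resBaseChange W K (x i) = 0) ∧ (∀ i, addOrderOf (x i) = 2) ∧
      ∀ c : Fin (2 * m + 2) → ℤ, ∑ i, c i • x i = 0 → ∀ i, (2 : ℤ) ∣ c i)
    (hker' : ∀ m < T, ∃ x : Fin (2 * m + 2) → Wd.galH1, (∀ i, resBaseChange Wd K (x i) = 0) ∧ (∀ i, addOrderOf (x i) = 2) ∧
      ∀ c : Fin (2 * m + 2) → ℤ, ∑ i, c i • x i = 0 → ∀ i, (2 : ℤ) ∣ c i) :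
    4 * T ≤ padicValNat 2 (Nat.card (AddCommGroup.primaryComponent W.sha 2)) +
      padicValNat 2 (Nat.card (AddCommGroup.primaryComponent Wd.sha 2)) + padicValNat 2 Wd.tamagawaProduct := by
  obtain ⟨hM, hM0, hMT, hfam, hfam'⟩ := genusLadder_of_kerFamilies W K Wd T hker hker'
  have h := hJ W hT hΔ K hIQ hodd hHe (2 * T) Wd hTw hB hg hg' T (fun j ↦ 2 * T - j) hM hM0 hMT hfam hfam'
  -- no `push_cast` (it would rewrite the casts to `padicValRat`); `omega` sees through the `ℕ → ℤ` casts
  omega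

/-- **ONE ROW REFUTES J.**  If some frame row (`W` globally minimal, `C(W)` odd, `Δ_W < 0`; `K` imaginary quadratic, `d_K` odd,
Heegner for `N_W`; `Wd` a globally minimal model of `W^{(d_K)}`; `ord₂ C(Wd) ≥ 2`; `Ш(W/ℚ)[2^∞]`, `Ш(Wd/ℚ)[2^∞]` finite) has
`ord₂ #Ш(W)[2^∞] + ord₂ #Ш(Wd)[2^∞] + ord₂ C(Wd) < 4` (on `Δ < 0`: `ord₂ C(Wd) = 3` and both `Ш[2] = 0`) and carries two
`𝔽₂`-independent order-`2` classes dying over `K` in `H¹(ℚ, W)` AND in `H¹(ℚ, Wd)` (genus classes `τ ↦ T`, `τ ↦ ψ(P)` of a rational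
`2`-torsion point and a twist point, independent modulo `(τ − 1)W(K)` — detected by reduction at a prime of `d_K` with
`Ẽ(𝔽_p)[2] ≅ (ℤ/2)²`), then the registered stub J is FALSE.  The row is NOT certified in this file. [cite: Kramer1981, Thm. 1, §5 Example] -/
theorem not_jointGenusCount_of_kerPairs [Wd.IsGloballyMinimal] (hT : Odd W.tamagawaProduct) (hΔ : W.Δ < 0)
    (hIQ : IsImaginaryQuadratic K) (hodd : Odd (NumberField.discr K)) (hHe : SatisfiesHeegnerHypothesis (W.conductorNorm ℤ) K)
    (hTw : ∃ C : VariableChange ℚ, C • W.quadraticTwist (NumberField.discr K : ℚ) = Wd) (hB : 2 ≤ padicValNat 2 Wd.tamagawaProduct)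
    (hg : 0 < Nat.card (AddCommGroup.primaryComponent W.sha 2)) (hg' : 0 < Nat.card (AddCommGroup.primaryComponent Wd.sha 2))
    (hrow : padicValNat 2 (Nat.card (AddCommGroup.primaryComponent W.sha 2)) +
      padicValNat 2 (Nat.card (AddCommGroup.primaryComponent Wd.sha 2)) + padicValNat 2 Wd.tamagawaProduct < 4)
    (x : Fin 2 → W.galH1) (hx : ∀ i, resBaseChange W K (x i) = 0) (hxo : ∀ i, addOrderOf (x i) = 2)
    (hxi : ∀ c : Fin 2 → ℤ, ∑ i, c i • x i = 0 → ∀ i, (2 : ℤ) ∣ c i)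
    (y : Fin 2 → Wd.galH1) (hy : ∀ i, resBaseChange Wd K (y i) = 0) (hyo : ∀ i, addOrderOf (y i) = 2)
    (hyi : ∀ c : Fin 2 → ℤ, ∑ i, c i • y i = 0 → ∀ i, (2 : ℤ) ∣ c i) :
    ¬ (∀ (W : WeierstrassCurve ℚ) [W.IsElliptic] [W.IsGloballyMinimal], Odd W.tamagawaProduct → W.Δ < 0 → ∀ (K : Type) [Field K] [NumberField K], Literature.NumberTheory.EllipticCurves.IsImaginaryQuadratic K → Odd (NumberField.discr K) → Literature.NumberTheory.EllipticCurves.SatisfiesHeegnerHypothesis (W.conductorNorm ℤ) K → ∀ (M₀ : ℕ) (Wd : WeierstrassCurve ℚ) [Wd.IsElliptic] [Wd.IsGloballyMinimal], (∃ C : WeierstrassCurve.VariableChange ℚ, C • W.quadraticTwist (NumberField.discr K : ℚ) = Wd) → 2 ≤ padicValNat 2 Wd.tamagawaProduct → 0 < Nat.card (AddCommGroup.primaryComponent W.sha 2) → 0 < Nat.card (AddCommGroup.primaryComponent Wd.sha 2) → ∀ (T : ℕ) (M : ℕ → ℕ), (∀ j, M (j + 1) ≤ M j) → M 0 = M₀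 → M (2 * T) = 0 → (∀ m < T, ∃ x : Fin (2 * m + 2) → W.galH1, (∀ i, resBaseChange W K (x i) ∈ (W.baseChange K).sha) ∧ (∀ i, addOrderOf (x i) = 2 ^ (M (2 * m) - M (2 * m + 1))) ∧ ∀ c : Fin (2 * m + 2) → ℤ, ∑ i, c i • x i = 0 → ∀ i, ((2 ^ (M (2 * m) - M (2 * m + 1)) : ℕ) : ℤ) ∣ c i) → (∀ m < T, ∃ x : Fin (2 * m + 2) → Wd.galH1, (∀ i, resBaseChange Wd K (x i) ∈ (Wd.baseChange K).sha) ∧ (∀ i, addOrderOf (x i) = 2 ^ (M (2 * m + 1) - M (2 * m + 2))) ∧ ∀ c : Fin (2 * m + 2) → ℤ, ∑ i, c i • x i = 0 → ∀ i, ((2 ^ (M (2 * m + 1) - M (2 * m + 2)) : ℕ) : ℤ) ∣ c i) → (2 * M₀ : ℤ) ≤ (padicValNat 2 (Nat.card (AddCommGroup.primaryComponent W.sha 2)) : ℤ) + (padicValNat 2 (Nat.card (AddCommGroup.primaryComponent Wd.sha 2)) : ℤ) + (padicValNat 2 Wd.tamagawaProduct : ℤ)) := by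
  intro hJ
  -- the row carries the `T = 1` genus ladders (`m = 0`: two classes on each side)
  have hker : ∀ m < 1, ∃ x : Fin (2 * m + 2) → W.galH1, (∀ i, resBaseChange W K (x i) = 0) ∧ (∀ i, addOrderOf (x i) = 2) ∧
      ∀ c : Fin (2 * m + 2) → ℤ, ∑ i, c i • x i = 0 → ∀ i, (2 : ℤ) ∣ c i := by
    intro m hm
    obtain rfl : m = 0 := by omega
    exact ⟨x, hx, hxo, hxi⟩
  have hker' : ∀ m < 1, ∃ x : Fin (2 * m + 2) → Wd.galH1, (∀ i, resBaseChange Wd K (x i) = 0) ∧ (∀ i, addOrderOf (x i) = 2) ∧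
      ∀ c : Fin (2 * m + 2) → ℤ, ∑ i, c i • x i = 0 → ∀ i, (2 : ℤ) ∣ c i := by
    intro m hm
    obtain rfl : m = 0 := by omega
    exact ⟨y, hy, hyo, hyi⟩
  have h := four_mul_le_of_jointGenusCount W K hJ hT hΔ hIQ hodd hHe hTw hB hg hg' 1 hker hker'
  omega

end Consequences

end Summit.BirchSwinnertonDyer.BirchSwinnertonDyer.Theorems.GenusExact.PlusDescent

end
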